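import Summits.BirchSwinnertonDyer.BirchSwinnertonDyer.Theses.GenusKolyvaginAtTwo
import Summits.BirchSwinnertonDyer.BirchSwinnertonDyer.Theorems.CMKolyvaginAtInertTwoCMExactDescentAtTwo
import Summits.BirchSwinnertonDyer.BirchSwinnertonDyer.Theorems.GenusKolyvaginAtTwoLeafCensusWallTorsionCell
import Summits.BirchSwinnertonDyer.BirchSwinnertonDyer.Theorems.ByReductionTypeAtTwoTwoTorsionIsogenyPairs
import Summits.BirchSwinnertonDyer.BirchSwinnertonDyer.Theorems.ByReductionTypeAtTwoMultTransportTwoIsogenyNormalForm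
import Summits.BirchSwinnertonDyer.BirchSwinnertonDyer.Theorems.TwoAdicConverseFullTwoTorsionRamified
import Literature.NumberTheory.EllipticCurves.NonvanishingTwists
import Literature.NumberTheory.EllipticCurves.ComplexMultiplicationHasCMIffProofs
import Literature.NumberTheory.EllipticCurves.MordellWeilProofs
import Literature.Barriers.BirchSwinnertonDyer.PAdicFunctionalEquationParityProofs
import HarnessLib

/-!
# LINE 46 «torsion_frame» v1.2 — crux `GenusKolyvaginAtTwo.RankOneTwoTorsionResidualAtTwo` (R″, item 27478)

Ideator `bsd-idea-1` (D-0145, gen 32), technique card «compactness–contradiction / rigidity», director focus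
«beyond-print theorems at p = 2».  HOME copy: `run/shared/lean/pub/ideators/bsd-idea-1/line46/`.

## Idea (one paragraph)

R″ = «`W/ℚ` globally minimal, non-CM, `r_an = 1`, `W(ℚ)[2] ≠ 0` ⟹ `BSD(W, 2)`».  Every line on this route that
uses a Heegner FRAME (an auxiliary imaginary quadratic `K` with the Heegner hypothesis) carries the Kolyvagin
reflex «`E[2]` irreducible / `ρ̄_{E,2}` surjective» — which is exactly what R″'s population violates, so the
frame was never pointed at the torsion cell.  But two tree theorems need NO image hypothesis at all:
(i) the EXACT Gross–Zagier identity over `K` on the model `W ⊗ K`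
(`CMExactDescent.shaAnOverC_baseChange_eq_of_heegner`: `#Ш_an(E/K) = 4·[E(K):ℤP]²/(c²·w_K²·(∏c_ℓ)²)` with the
FULL index, torsion included), and (ii) Milne/Dokchitser descent `K → ℚ`
(`AdditivePotMult.missingPPartOverCAt_baseChange_iff_bsdp`: `BSD_p(E) ⟺ [p-part of BSD for E/K]` given
`BSD_p` of the twin `E^{(d_K)}`).  On the torsion cell the twin `E^{(d_K)}` chosen by Waldspurger
(`L(E^{(d_K)},1) ≠ 0`) is a NON-CM RANK-ZERO curve, i.e. it lies in the four WALL rows that GK2's `closes`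
already binds.  Hence (kernel, both directions, §5):

  WALL ∧ PRINT ⊢  CYC  ⟺  GROSS INDEX LAW AT 2 :
  «for every cyclic-torsion non-CM `W` with `r_an = 1` and every Heegner field `K` with `r_an(W^{(d_K)}) = 0`,
   `ord₂ #Ш(W ⊗ K) = 2 + 2·ord₂ [E(K):ℤP_K] − 2·ord₂ c − 2·ord₂ w_K − 2·ord₂ ∏_ℓ c_ℓ(W)`»
  (`MissingPPartOverCAt (W.baseChange K) 2`, unfolded in §6 under any Heegner point `P_K`).

The TORSION is INSIDE the index: §6 proves `2 ∣ #E(K)_tors ∣ [E(K):ℤP]` on the torsion cell (kernel), so the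
law is a statement about the torsion-and-Tamagawa-corrected Heegner index over ONE auxiliary field — a single
Diophantine/2-adic target per curve, with the rank-0 twin discharged by WALL instead of by a second descent.
(v1.1) The law SPLITS into two HALVES with different technique owners (§0, §5 `grossIndexLaw_of_halves` /
`halves_of_grossIndexLaw` / `cyc_iff_halves`, kernel): the UPPER half `ord₂ #Ш(W ⊗ K) ≤ ord₂ #Ш_an(W ⊗ K)` is the
Euler-system / Jetchev direction (index DIVISIBLE by torsion·Manin·Tamagawa at 2 — its cheapest consequence is the
Gross–Zagier 2-integrality `two_integrality_of_upperHalf`, observed in 1214/1214 census pairs), the LOWER half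
`ord₂ #Ш_an ≤ ord₂ #Ш` is the construction direction (extra 2-divisibility of the Heegner point FORCES elements of
`Ш(W ⊗ K)[2^∞]` — visibility / capitulation in `K/ℚ` / explicit 2-descent over `K`; no image hypothesis in sight).
Combined with LINE 45's real leaf (§§2–4, `PRINT → CYC → RES-A`), the file proves R″ BY NAME from
{WALL (route binders), PRINT (named facts), UPPER half, LOWER half (research)}.
(v1.2) §8 ℚ-CURRENCY (kernel): the halves are intrinsic to `W` — `CyclicUpperHalfOverQAtTwo` / `CyclicLowerHalfOverQAtTwo`
(conclusions `MissingUpperBoundAt W 2` / `MissingLowerBoundAt W 2`) satisfy CYC ⟺ UPPER_ℚ ∧ LOWER_ℚ modulo GZK alone and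
UPPER_K ⟺ UPPER_ℚ, LOWER_K ⟺ LOWER_ℚ modulo WALL + PRINT; census slack ≥ 0 now 1214/1214 (kit:j343575) and the ℚ-side 2-descent
instrument B′ (kit:j343633) finds `Ш(E)[2] = 0` on 607/607 curves, twin data vs BSD₂ 0 FAIL / 1214.

HONEST STANDING.  UPPER ∧ LOWER is EQUIVALENT to CYC modulo WALL + PRINT (§5 proves both directions) — a
lossless change of language followed by a genuine two-owner split, not a weakening; its value is the explicit
one-sided targets (§6) and the instruments they enable (card §Instrument: kit:j343520 index census — integrality
279/279; kit:j343542 Simon 2-descent over `K` against the predicted `#Ш(W ⊗ K)[2^∞] = 4^slack`).  No summit, no rung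
and no crux is proved by this file; R″ stays OPEN.

## Prover-facing shape (critic #675 P1): `GrossIndexLawExistsAtTwo` (ONE Heegner field per curve) — §5 `cyc_of_grossIndexLawExists`
(sufficient, kernel) / `grossIndexLawExists_of_cyc` (lossless, kernel) / `grossIndexLawExists_of_halves`.
## Stubs (the ONLY sorries): `stub_wallByName`, `stub_print`, `stub_grossIndexUpperHalfAtTwo`, `stub_grossIndexLowerHalfAtTwo`.
## Kernel-checked: §§2–4 (LINE 45 leaf, verbatim), §5 `exists_minimalTwin_bsdp_of_wall`, `cyc_of_grossIndexLaw`,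
`grossIndexLaw_of_cyc` (lossless), `grossIndexLaw_of_halves`, `halves_of_grossIndexLaw`, `cyc_iff_halves`,
§6 `missingPPartOverCAt_two_iff_indexQuotient`, `padicValRat_grossIndexQuotient`, `missing{PPart,UpperBound,LowerBound}OverCAt_two_iff_valuation`,
`two_integrality_of_upperHalf`, `natCard_torsion_dvd_index_zmultiples`, `two_dvd_index_zmultiples_of_rational_two_torsion`,
§7 `residual_of_inputs`, `RankOneTwoTorsionResidualAtTwo_of : RankOneTwoTorsionResidualAtTwo` BY NAME.
Bears on: LADDER-BSD rung «rank one at 2, reducible residual»; GK2 `closes` binder 27478 (and, via the same frame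
with `#Sel₂` bookkeeping, 27477/22985 — not attempted here).
-/

noncomputable section

open scoped Classical
open WeierstrassCurve NumberField Literature Literature.NumberTheory.EllipticCurves
  Literature.NumberTheory.EllipticCurves.Rank1Residual
  Literature.NumberTheory.EllipticCurves.Rank1Residual.Typed
  Literature.NumberTheory.EllipticCurves.Greenberg1999
  Literature.NumberTheory.EllipticCurves.ModularForms
  Summit.BirchSwinnertonDyer.BirchSwinnertonDyer.Theses.GenusKolyvaginAtTwo
  Summit.BirchSwinnertonDyer.BirchSwinnertonDyer.Theorems.TwoAdicOffHabitat
  Summit.BirchSwinnertonDyer.BirchSwinnertonDyer.Theorems.TwoAdicTwistConverse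
  Summit.BirchSwinnertonDyer.BirchSwinnertonDyer.Theorems.MultTransportTwistedDescent
  Summit.BirchSwinnertonDyer.BirchSwinnertonDyer.Theorems.GenusExact.Census.TorsionCell
  Summit.BirchSwinnertonDyer.BirchSwinnertonDyer.Theorems.CMExactDescent
  Summit.BirchSwinnertonDyer.Rank1Residual.AdditivePotMult

namespace Summit.BirchSwinnertonDyer.BirchSwinnertonDyer.Cruxes.RankOneTwoTorsionResidualAtTwo.TorsionFrame

/-! ## §0 Definitions (CYC / RES-A texts identical to LINES 44/45, so the items coincide on merge) -/

/-- **Cyclic rational `2`-torsion**: at most ONE non-zero rational point killed by `2` (`W(ℚ)[2] ⊆ ℤ/2`). -/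
def HasCyclicRationalTwoTorsion (W : WeierstrassCurve ℚ) : Prop :=
  ∀ P Q : W.toAffine.Point, 2 • P = 0 → 2 • Q = 0 → P ≠ 0 → Q ≠ 0 → P = Q

/-- **RES-A** (full rational `2`-torsion residual; DERIVED from CYC + PRINT in §4). -/
def FullTwoTorsionRankOneResidualAtTwo : Prop :=
  ∀ (W : WeierstrassCurve ℚ) [W.IsElliptic] [W.IsGloballyMinimal],
    ¬ W.HasCM → W.analyticRank = 1 → (¬ ∀ P : W.toAffine.Point, 2 • P = 0 → P = 0) →
      ¬ HasCyclicRationalTwoTorsion W → BSDp W 2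

/-- **CYC** — R″ restricted to cyclic rational `2`-torsion (`W(ℚ)[2] = ℤ/2`). -/
def CyclicTwoTorsionRankOneAtTwo : Prop :=
  ∀ (W : WeierstrassCurve ℚ) [W.IsElliptic] [W.IsGloballyMinimal],
    ¬ W.HasCM → W.analyticRank = 1 → (¬ ∀ P : W.toAffine.Point, 2 • P = 0 → P = 0) →
      HasCyclicRationalTwoTorsion W → BSDp W 2

/-- **GROSS INDEX LAW AT 2 on the torsion cell** (research stub; the `2`-part of Gross's conjecture (2.2) over ONE
Heegner field).  For every globally minimal non-CM `W/ℚ` with `r_an = 1` and cyclic non-trivial rational `2`-torsion,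
and every imaginary quadratic `K` satisfying the Heegner hypothesis for `N_W` whose twin `W^{(d_K)}` has analytic
rank `0`: the `2`-part of BSD for `W ⊗ K` in Dokchitser–Dokchitser currency, `ord₂ #Ш_an(W ⊗ K) = ord₂ #Ш(W ⊗ K)`
(`AdditivePotMult.MissingPPartOverCAt`; by §6 this reads `ord₂ #Ш(W ⊗ K) = 2 + 2·ord₂[E(K):ℤP] − 2·ord₂ c −
2·ord₂ w_K − 2·ord₂ ∏c_ℓ` under any Heegner point `P`).  EQUIVALENT to CYC modulo WALL + PRINT (§5).
[cite: GrossLMS1991, §2 Conj. (2.2)] [cite: GrossZagier1986, V.(2.1)–(2.2)] -/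
def GrossIndexLawAtTwo : Prop :=
  ∀ (W : WeierstrassCurve ℚ) [W.IsElliptic] [W.IsGloballyMinimal],
    ¬ W.HasCM → W.analyticRank = 1 → (¬ ∀ P : W.toAffine.Point, 2 • P = 0 → P = 0) →
    HasCyclicRationalTwoTorsion W →
    ∀ (K : Type) [Field K] [NumberField K], IsImaginaryQuadratic K →
      SatisfiesHeegnerHypothesis (W.conductorNorm ℤ) K →
      (W.quadraticTwist (NumberField.discr K : ℚ)).analyticRank = 0 →
      MissingPPartOverCAt (W.baseChange K) 2

/-- **UPPER HALF — the Euler-system / Jetchev direction** (research): on the same cell and frame,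
`ord₂ #Ш(W ⊗ K) ≤ ord₂ #Ш_an(W ⊗ K)` (`AdditivePotMult.MissingUpperBoundOverCAt`); under a Heegner point (§6)
`ord₂ #Ш(W ⊗ K) ≤ 2 + 2·ord₂[E(K):ℤP] − 2·ord₂ c − 2·ord₂ w_K − 2·ord₂ ∏c_ℓ`, whose cheapest consequence is the
GROSS–ZAGIER 2-INTEGRALITY `ord₂ c + ord₂ w_K + ord₂ ∏c_ℓ ≤ 1 + ord₂[E(K):ℤP]` (`two_integrality_of_upperHalf`) — the `p = 2`,
reducible-`E[2]` analogue of Jetchev's divisibility `m_∞ ≥ m_max` (proved for `p` odd, `p ∤ N`, `ρ̄_{E,p}` surjective, using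
`E(ℚ)[p] = 0`).  On the torsion cell the rational `2`-torsion point is itself a factor of the index (§6).
[cite: JetchevCompositio2008, Thm. 1.4, Conj. 1.3] [cite: GrossLMS1991, §2 (2.2)–(2.3)] -/
def GrossIndexUpperHalfAtTwo : Prop :=
  ∀ (W : WeierstrassCurve ℚ) [W.IsElliptic] [W.IsGloballyMinimal],
    ¬ W.HasCM → W.analyticRank = 1 → (¬ ∀ P : W.toAffine.Point, 2 • P = 0 → P = 0) →
    HasCyclicRationalTwoTorsion W →
    ∀ (K : Type) [Field K] [NumberField K], IsImaginaryQuadratic K →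
      SatisfiesHeegnerHypothesis (W.conductorNorm ℤ) K →
      (W.quadraticTwist (NumberField.discr K : ℚ)).analyticRank = 0 →
      MissingUpperBoundOverCAt (W.baseChange K) 2

/-- **LOWER HALF — the construction / main-conjecture direction** (research): on the same cell and frame,
`ord₂ #Ш_an(W ⊗ K) ≤ ord₂ #Ш(W ⊗ K)` (`AdditivePotMult.MissingLowerBoundOverCAt`); under a Heegner point (§6)
`2 + 2·ord₂[E(K):ℤP] − 2·ord₂ c − 2·ord₂ w_K − 2·ord₂ ∏c_ℓ ≤ ord₂ #Ш(W ⊗ K)`: wherever the Heegner point is MORE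
`2`-divisible in `E(K)` than torsion, Manin and Tamagawa force, elements of `Ш(W ⊗ K)[2^∞]` must be CONSTRUCTED
(visibility / capitulation in `K/ℚ` / explicit `2`-descent over `K`) — no Galois-image hypothesis is involved in the
statement or in those tools.  [cite: GrossLMS1991, §2 (2.2)] [cite: Kramer1981, Thm. 1] -/
def GrossIndexLowerHalfAtTwo : Prop :=
  ∀ (W : WeierstrassCurve ℚ) [W.IsElliptic] [W.IsGloballyMinimal],
    ¬ W.HasCM → W.analyticRank = 1 → (¬ ∀ P : W.toAffine.Point, 2 • P = 0 → P = 0) →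
    HasCyclicRationalTwoTorsion W →
    ∀ (K : Type) [Field K] [NumberField K], IsImaginaryQuadratic K →
      SatisfiesHeegnerHypothesis (W.conductorNorm ℤ) K →
      (W.quadraticTwist (NumberField.discr K : ℚ)).analyticRank = 0 →
      MissingLowerBoundOverCAt (W.baseChange K) 2

/-- **LAW∃ — the prover-facing shape** (critic #675 P1): per curve, ONE Heegner field `K` with rank-zero twin on which the
`2`-part over `K` holds.  Weaker than the `∀K` law, still sufficient for CYC (§5 `cyc_of_grossIndexLawExists`, the same
five lines), and implied by CYC/LAW given Waldspurger's frame (§5 `grossIndexLawExists_of_grossIndexLaw`, newform + Waldspurger).  The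
instruments work in this shape (two `D` per curve). -/
def GrossIndexLawExistsAtTwo : Prop :=
  ∀ (W : WeierstrassCurve ℚ) [W.IsElliptic] [W.IsGloballyMinimal],
    ¬ W.HasCM → W.analyticRank = 1 → (¬ ∀ P : W.toAffine.Point, 2 • P = 0 → P = 0) →
    HasCyclicRationalTwoTorsion W →
    ∃ (K : Type) (_ : Field K) (_ : NumberField K),
      IsImaginaryQuadratic K ∧ SatisfiesHeegnerHypothesis (W.conductorNorm ℤ) K ∧
        (W.quadraticTwist (NumberField.discr K : ℚ)).analyticRank = 0 ∧ MissingPPartOverCAt (W.baseChange K) 2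

/-! ## §1 The registered stubs (the ONLY sorries of this file) -/

/-- WALL — the four GK2 wall rows BY NAME (route binders 19095–19098: BSD₂ for non-CM rank-zero curves by reduction
type at `2`; open, staffed on the route; nothing new asserted here). -/
theorem stub_wallByName :
    WallGoodOrdinaryRankZeroAtTwo ∧ WallMultiplicativeRankZeroAtTwo ∧ WallSupersingularRankZeroAtTwo ∧
      WallAdditiveRankZeroAtTwo := by
  sorry

/-- PRINT — named Literature facts AS PRINTED (nothing asserted by the tree): Gross–Zagier–Kolyvagin `rank = r_an ≤ 1`,
Cassels' isogeny invariance of the BSD quotient, modularity (entire `L`, and a weight-2 newform of level `N_W`),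
the Weil-restriction/Dokchitser comparison of BSD quotients under quadratic base change, and Waldspurger's
non-vanishing twist in a Heegner field.  [cite: GrossZagier1986] [cite: Kolyvagin1990] [cite: Cassels1965ArithmeticVIII]
[cite: BCDTJAMS2001, Thm. A] [cite: DokchitserDokchitserAnnals2010, §2.1] [cite: Milne1972ArithmeticAV, §1 Thm. 1]
[cite: Darmon2004, §3.9, proof of Thm. 3.22] -/
theorem stub_print :
    rank_eq_analyticRank_of_analyticRank_le_one ∧ bsdRHS_eq_of_isIsogenous ∧ hasEntireLFunction_rat ∧
      exists_isNewformOf ∧ Milne1972.bsdQuotient_baseChange_quadratic_anyModel ∧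
        waldspurger_exists_heegnerField_twist_ne_zero := by
  sorry

/-- GROSS INDEX LAW AT 2, UPPER HALF (research; Euler-system / Jetchev direction — the barrier side: every printed
route to it runs a Kolyvagin system and needs `ρ̄_{E,2}` irreducible; here `E[2]` is reducible). -/
theorem stub_grossIndexUpperHalfAtTwo : GrossIndexUpperHalfAtTwo := by
  sorry

/-- GROSS INDEX LAW AT 2, LOWER HALF (research; construction direction — no image hypothesis in statement or tools:
visibility, capitulation under `K/ℚ`, explicit `2`-descent over `K`). -/
theorem stub_grossIndexLowerHalfAtTwo : GrossIndexLowerHalfAtTwo := by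
  sorry

/-! ## §2 Kernel-checked (carried from LINE 45 «real_leaf», verbatim): points of order two and their abscissae -/

section Points

variable {W : WeierstrassCurve ℚ}

/-- A non-zero rational point killed by `2` is an affine point `(x, y)` with `2y + a₁x + a₃ = 0`.
[cite: SilvermanAEC2009, III.2.3] -/
theorem exists_xy_of_two_nsmul_eq_zero {P : W.toAffine.Point} (hP0 : P ≠ 0) (h2 : 2 • P = 0) :
    ∃ (x y : ℚ) (h : W.toAffine.Nonsingular x y), P = .some x y h ∧ 2 * y + W.a₁ * x + W.a₃ = 0 := by
  rcases P with _ | ⟨x, y, hns⟩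
  · exact absurd rfl hP0
  · refine ⟨x, y, hns, rfl, ?_⟩
    by_contra hy'
    have hy : y ≠ W.toAffine.negY x y := by
      intro h
      apply hy'
      rw [WeierstrassCurve.Affine.negY] at h
      linear_combination h
    rw [two_nsmul, WeierstrassCurve.Affine.Point.add_self_of_Y_ne hy] at h2
    exact WeierstrassCurve.Affine.Point.some_ne_zero _ h2

/-- A rational point of order `2` is determined by its abscissa (`y = −(a₁x + a₃)/2`). [cite: SilvermanAEC2009, III.2.3] -/
theorem some_eq_some_of_two_torsion {x y₁ y₂ : ℚ} (h₁ : W.toAffine.Nonsingular x y₁) (h₂ : W.toAffine.Nonsingular x y₂)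
    (e₁ : 2 * y₁ + W.a₁ * x + W.a₃ = 0) (e₂ : 2 * y₂ + W.a₁ * x + W.a₃ = 0) :
    (WeierstrassCurve.Affine.Point.some x y₁ h₁ : W.toAffine.Point) = .some x y₂ h₂ := by
  have hy : y₁ = y₂ := by linarith
  subst hy
  rfl

/-- **`(ℤ/2)² ⊆ W(ℚ)` ⟹ three pairwise distinct rational `2`-torsion abscissae** (the tree's spelling of «full rational
`2`-torsion», e.g. in `matsuno2008_prop62_lambda_fullTwoTorsion_two`): two distinct non-zero points `P, Q` killed by `2`
and their sum.  [cite: SilvermanAEC2009, III.2.3] -/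
theorem exists_three_abscissae_of_not_hasCyclic (hfull : ¬ HasCyclicRationalTwoTorsion W) :
    ∃ x₁ x₂ x₃ : ℚ, x₁ ≠ x₂ ∧ x₁ ≠ x₃ ∧ x₂ ≠ x₃ ∧ HasRationalTwoTorsionX W x₁ ∧
      HasRationalTwoTorsionX W x₂ ∧ HasRationalTwoTorsionX W x₃ := by
  unfold HasCyclicRationalTwoTorsion at hfull
  push Not at hfull
  obtain ⟨P, Q, h2P, h2Q, hP0, hQ0, hPQ⟩ := hfull
  -- the third point `R = P + Q`
  have hnegP : -P = P := by
    rw [neg_eq_iff_add_eq_zero, ← two_nsmul]; exact h2P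
  have h2R : 2 • (P + Q) = 0 := by rw [nsmul_add, h2P, h2Q, add_zero]
  have hR0 : P + Q ≠ 0 := by
    intro h
    have hQ : Q = -P := eq_neg_of_add_eq_zero_right h
    rw [hnegP] at hQ
    exact hPQ hQ.symm
  have hRP : P + Q ≠ P := fun h ↦ hQ0 (add_left_cancel (h.trans (add_zero P).symm))
  have hRQ : P + Q ≠ Q := fun h ↦ hP0 (add_right_cancel (h.trans (zero_add Q).symm))
  obtain ⟨xP, yP, hP, rfl, eP⟩ := exists_xy_of_two_nsmul_eq_zero hP0 h2P
  obtain ⟨xQ, yQ, hQ, rfl, eQ⟩ := exists_xy_of_two_nsmul_eq_zero hQ0 h2Q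
  obtain ⟨xR, yR, hR, hReq, eR⟩ := exists_xy_of_two_nsmul_eq_zero hR0 h2R
  refine ⟨xP, xQ, xR, ?_, ?_, ?_, ⟨yP, hP.left, eP⟩, ⟨yQ, hQ.left, eQ⟩, ⟨yR, hR.left, eR⟩⟩
  · rintro rfl
    exact hPQ (some_eq_some_of_two_torsion hP hQ eP eQ)
  · rintro rfl
    exact hRP (hReq.trans (some_eq_some_of_two_torsion hR hP eR eP))
  · rintro rfl
    exact hRQ (hReq.trans (some_eq_some_of_two_torsion hR hQ eR eQ))

/-- Conversely, a UNIQUE rational `2`-torsion abscissa means cyclic rational `2`-torsion. [cite: SilvermanAEC2009, III.2.3] -/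
theorem hasCyclic_of_hasUniqueRationalTwoTorsionX {x : ℚ} (h : HasUniqueRationalTwoTorsionX W x) :
    HasCyclicRationalTwoTorsion W := by
  intro P Q h2P h2Q hP0 hQ0
  obtain ⟨xP, yP, hP, rfl, eP⟩ := exists_xy_of_two_nsmul_eq_zero hP0 h2P
  obtain ⟨xQ, yQ, hQ, rfl, eQ⟩ := exists_xy_of_two_nsmul_eq_zero hQ0 h2Q
  have hxP : xP = x := h.2 xP ⟨yP, hP.left, eP⟩
  have hxQ : xQ = x := h.2 xQ ⟨yQ, hQ.left, eQ⟩
  subst hxP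
  subst hxQ
  exact some_eq_some_of_two_torsion hP hQ eP eQ

end Points

/-! ## §3 Kernel-checked (LINE 45): SIGN RIGIDITY — the three normal-form coefficients are never all squares -/

/-- **Sign rigidity.**  For three pairwise distinct rational `2`-torsion abscissae `x₁, x₂, x₃` of `W`, the normal-form
coefficients `bᵢ = 3xᵢ² + (b₂/2)xᵢ + b₄/2 = (xᵢ − xⱼ)(xᵢ − xₖ)` have product `−((x₁−x₂)(x₁−x₃)(x₂−x₃))² < 0`; hence NOT all
three are squares in `ℚ`.  [cite: SilvermanAEC2009, III.2.3 (ψ₂) and III.4 Ex. 4.5] -/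
theorem sign_rigidity_not_all_isSquare (W : WeierstrassCurve ℚ) {x₁ x₂ x₃ : ℚ} (h12 : x₁ ≠ x₂) (h13 : x₁ ≠ x₃)
    (h23 : x₂ ≠ x₃) (h₁ : HasRationalTwoTorsionX W x₁) (h₂ : HasRationalTwoTorsionX W x₂)
    (h₃ : HasRationalTwoTorsionX W x₃) :
    ∃ x : ℚ, HasRationalTwoTorsionX W x ∧ ¬ IsSquare (3 * x ^ 2 + W.b₂ / 2 * x + W.b₄ / 2) := by
  obtain ⟨y₁, hE₁, e₁⟩ := h₁
  obtain ⟨y₂, hE₂, e₂⟩ := h₂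
  obtain ⟨y₃, hE₃, e₃⟩ := h₃
  obtain ⟨hS, hS₂, -⟩ := vieta_of_three_twoTorsion_roots (fourXCubed_add_eq_zero_of_twoTorsion hE₁ e₁)
    (fourXCubed_add_eq_zero_of_twoTorsion hE₂ e₂) (fourXCubed_add_eq_zero_of_twoTorsion hE₃ e₃) h12 h13 h23
  by_contra hall
  push Not at hall
  obtain ⟨r₁, hr₁⟩ := hall x₁ ⟨y₁, hE₁, e₁⟩
  obtain ⟨r₂, hr₂⟩ := hall x₂ ⟨y₂, hE₂, e₂⟩
  obtain ⟨r₃, hr₃⟩ := hall x₃ ⟨y₃, hE₃, e₃⟩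
  -- the product of the three coefficients is minus a non-zero square
  have hD : (x₁ - x₂) * (x₁ - x₃) * (x₂ - x₃) ≠ 0 :=
    mul_ne_zero (mul_ne_zero (sub_ne_zero.mpr h12) (sub_ne_zero.mpr h13)) (sub_ne_zero.mpr h23)
  have hprod : (3 * x₁ ^ 2 + W.b₂ / 2 * x₁ + W.b₄ / 2) * (3 * x₂ ^ 2 + W.b₂ / 2 * x₂ + W.b₄ / 2) *
      (3 * x₃ ^ 2 + W.b₂ / 2 * x₃ + W.b₄ / 2) = -(((x₁ - x₂) * (x₁ - x₃) * (x₂ - x₃)) ^ 2) := by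
    have eb₂ : W.b₂ = -4 * (x₁ + x₂ + x₃) := by linear_combination hS
    have eb₄ : W.b₄ = 2 * (x₁ * x₂ + x₁ * x₃ + x₂ * x₃) := by linear_combination (-(1 : ℚ) / 2) * hS₂
    rw [eb₂, eb₄]; ring
  have hpos : 0 < ((x₁ - x₂) * (x₁ - x₃) * (x₂ - x₃)) ^ 2 := by positivity
  have hsq : 0 ≤ (r₁ * r₂ * r₃) * (r₁ * r₂ * r₃) := mul_self_nonneg _
  have hprod' : (3 * x₁ ^ 2 + W.b₂ / 2 * x₁ + W.b₄ / 2) * (3 * x₂ ^ 2 + W.b₂ / 2 * x₂ + W.b₄ / 2) *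
      (3 * x₃ ^ 2 + W.b₂ / 2 * x₃ + W.b₄ / 2) = (r₁ * r₂ * r₃) * (r₁ * r₂ * r₃) := by
    rw [hr₁, hr₂, hr₃]; ring
  rw [hprod'] at hprod
  linarith

/-! ## §4 Kernel-checked (LINE 45): the CYCLIC PARTNER and the transport `PRINT → CYC → RES-A` -/

/-- **The cyclic partner.**  A curve with full rational `2`-torsion is in two-torsion normal form (after a change of variables
`C`) at a point `Tᵢ` whose normal-form coefficient `b = (C • W).a₄` is NOT a square; Silverman's `2`-isogeny quotient
`(C • W).twoIsogenyCodomain` then has EXACTLY ONE rational point of order `2`.  [cite: SilvermanAEC2009, III.4 Ex. 4.5, X.4 Prop. 4.9] -/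
theorem exists_partner_uniqueTwoTorsion (W : WeierstrassCurve ℚ) [W.IsElliptic] (hfull : ¬ HasCyclicRationalTwoTorsion W) :
    ∃ C : VariableChange ℚ, (C • W).IsTwoTorsionNF ∧ HasUniqueRationalTwoTorsionX (C • W).twoIsogenyCodomain 0 := by
  obtain ⟨x₁, x₂, x₃, h12, h13, h23, h₁, h₂, h₃⟩ := exists_three_abscissae_of_not_hasCyclic hfull
  obtain ⟨x₀, ⟨y₀, hEq, h2⟩, hnsq⟩ := sign_rigidity_not_all_isSquare W h12 h13 h23 h₁ h₂ h₃
  obtain ⟨C, hNF, -, -, -, ha₄⟩ := exists_variableChange_twoTorsionNF W hEq h2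
  haveI := hNF
  refine ⟨C, hNF, ?_⟩
  rw [hasUniqueRationalTwoTorsionX_twoIsogenyCodomain_zero_iff (C • W), ha₄]
  exact hnsq

/-- **RES-A IS DERIVED: full ⟹ cyclic** (the theorem of this line).  Modulo PRINT {GZK, Cassels, modularity}: if `BSD(·,2)`
holds on the globally minimal non-CM rank-one curves with cyclic non-trivial rational `2`-torsion, it holds on those with full
rational `2`-torsion — pass to the globally minimal model `W′` of the cyclic partner (`r_an`, CM are isogeny invariants; the
unique rational `2`-torsion abscissa moves along the change of variables) and transport `BSD₂` back along the `ℤ/2`-linked pair.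
[cite: MilneADT2006, Thm. I.7.3] [cite: Cassels1965ArithmeticVIII] [cite: SilvermanAEC2009, III.4 Ex. 4.5] -/
theorem fullTwoTorsionResidual_of_cyclic (hGZK : rank_eq_analyticRank_of_analyticRank_le_one)
    (hCassels : bsdRHS_eq_of_isIsogenous) (hmod : hasEntireLFunction_rat) (hcyc : CyclicTwoTorsionRankOneAtTwo) :
    FullTwoTorsionRankOneResidualAtTwo := by
  intro W _ _ hCM hr hT hfull
  obtain ⟨C, hNF, huniq⟩ := exists_partner_uniqueTwoTorsion W hfull
  haveI := hNF
  obtain ⟨C₀, hmin⟩ := hasGlobalMinimalModel_rat_holds (C • W).twoIsogenyCodomain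
  set W' : WeierstrassCurve ℚ := C₀ • (C • W).twoIsogenyCodomain with hW'
  haveI : W'.IsGloballyMinimal := hmin
  have hlink : C₀⁻¹ • W' = (C • W).twoIsogenyCodomain := inv_smul_smul C₀ _
  have hCM' : ¬ W'.HasCM := fun h ↦ hCM ((hasCM_iff_of_twoTorsionPair hlink).mpr h)
  have hr' : W'.analyticRank = 1 := (analyticRank_eq_of_twoTorsionPair hlink) ▸ hr
  have huniq' : HasUniqueRationalTwoTorsionX W' (C₀.toX 0) :=
    (hasUniqueRationalTwoTorsionX_smul_toX_iff (C • W).twoIsogenyCodomain C₀ 0).mpr huniq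
  have hT' : ¬ ∀ P : W'.toAffine.Point, 2 • P = 0 → P = 0 := by
    obtain ⟨P, hP0, h2P⟩ := (exists_two_torsion_iff_exists_hasRationalTwoTorsionX W').mpr ⟨_, huniq'.1⟩
    exact fun h ↦ hP0 (h P h2P)
  have h' : BSDp W' 2 := hcyc W' hCM' hr' hT' (hasCyclic_of_hasUniqueRationalTwoTorsionX huniq')
  exact (bsdp_two_iff_of_twoTorsionPair hGZK hCassels hmod hlink hr.le).mpr h'

/-! ## §5 Kernel-checked: the TORSION FRAME — `WALL ∧ PRINT ⊢ CYC ⟺ GROSS INDEX LAW AT 2` -/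

/-- CM is read off `j`, so a model of a quadratic twist of a non-CM curve is non-CM. -/
theorem not_hasCM_of_smul_quadraticTwist {W : WeierstrassCurve ℚ} [W.IsElliptic] (hcm : ¬ W.HasCM) {d : ℚ}
    (hd : d ≠ 0) (C : VariableChange ℚ) {Wd : WeierstrassCurve ℚ} [Wd.IsElliptic]
    (hWd : C • W.quadraticTwist d = Wd) : ¬ Wd.HasCM := by
  haveI := W.isElliptic_quadraticTwist hd
  intro h
  have hiff := hasCM_iff_j_mem_of_heegnerStarkPrime
    Literature.NumberTheory.QuadraticFields.BinaryQuadraticForm.HeegnerStarkPrimeThreeModEight_holds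
  have hj : Wd.j ∈ cmJInvariants := (hiff Wd).1 h
  have hjj : Wd.j = W.j := by
    subst hWd
    rw [WeierstrassCurve.variableChange_j, W.j_quadraticTwist hd]
  rw [hjj] at hj
  exact hcm ((hiff W).2 hj)

/-- **The twin is in the WALL.**  For `W` non-CM and `K` quadratic with `r_an(W^{(d_K)}) = 0`, a globally minimal model
`Wd` of the twin is non-CM of analytic rank `0`, so the four WALL rows give `BSD(Wd, 2)`. -/
theorem exists_minimalTwin_bsdp_of_wall
    (hOrd : WallGoodOrdinaryRankZeroAtTwo) (hMult : WallMultiplicativeRankZeroAtTwo)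
    (hSS : WallSupersingularRankZeroAtTwo) (hAdd : WallAdditiveRankZeroAtTwo)
    (W : WeierstrassCurve ℚ) [W.IsElliptic] (hcm : ¬ W.HasCM)
    (K : Type) [Field K] [NumberField K]
    (hrd0 : (W.quadraticTwist (NumberField.discr K : ℚ)).analyticRank = 0) :
    ∃ (Wd : WeierstrassCurve ℚ) (_ : Wd.IsElliptic) (_ : Wd.IsGloballyMinimal),
      (∃ C : VariableChange ℚ, C • W.quadraticTwist (NumberField.discr K : ℚ) = Wd) ∧
        Wd.analyticRank = 0 ∧ BSDp Wd 2 := by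
  have hD0 : (NumberField.discr K : ℚ) ≠ 0 := by exact_mod_cast NumberField.discr_ne_zero K
  haveI hEt : (W.quadraticTwist (NumberField.discr K : ℚ)).IsElliptic := W.isElliptic_quadraticTwist hD0
  obtain ⟨C, hmin⟩ := hasGlobalMinimalModel_rat_holds (W.quadraticTwist (NumberField.discr K : ℚ))
  haveI : (C • W.quadraticTwist (NumberField.discr K : ℚ)).IsGloballyMinimal := hmin
  have hrd : (C • W.quadraticTwist (NumberField.discr K : ℚ)).analyticRank = 0 := by
    rw [analyticRank_smul]; exact hrd0
  have hcmd : ¬ (C • W.quadraticTwist (NumberField.discr K : ℚ)).HasCM :=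
    not_hasCM_of_smul_quadraticTwist hcm hD0 C rfl
  exact ⟨C • W.quadraticTwist (NumberField.discr K : ℚ), inferInstance, hmin, ⟨C, rfl⟩, hrd,
    bsdp_rankZero_of_wallGK2 hOrd hMult hSS hAdd _ hcmd hrd⟩

/-- Analytic rank `1` forces root number `−1` (parity of the order of vanishing, from a newform of level `N_W`). -/
theorem rootNumber_eq_neg_one_of_analyticRank_eq_one (hnf : exists_isNewformOf)
    (W : WeierstrassCurve ℚ) [W.IsElliptic] [W.IsGloballyMinimal] [NeZero (W.conductorNorm ℤ)]
    (hr : W.analyticRank = 1) : W.rootNumber = -1 := by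
  obtain ⟨f, hf⟩ := hnf W
  rcases W.rootNumber_eq_one_or with h | h
  · exfalso
    have hev : Even W.analyticRank :=
      (Literature.Barriers.BirchSwinnertonDyer.even_analyticRank_iff_of_isNewformOf_conductorLevel hf).mpr h
    rw [hr] at hev
    exact Nat.not_even_one hev
  · exact h

/-- **CYC ⟸ WALL + PRINT + GROSS INDEX LAW** (the frame, forward).  Chain: `r_an(W) = 1` ⟹ `ε(W) = −1`
(modularity) ⟹ Waldspurger: a Heegner field `K` with `L(W^{(d_K)},1) ≠ 0` ⟹ twin in the WALL
(`exists_minimalTwin_bsdp_of_wall`) ⟹ the law gives the `2`-part over `K` ⟹ Milne/Dokchitser descent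
(`bsdp_of_pPartOverC_baseChange`) gives `BSD(W, 2)`.  No image / torsion hypothesis anywhere. -/
theorem cyc_of_grossIndexLaw
    (hW : WallGoodOrdinaryRankZeroAtTwo ∧ WallMultiplicativeRankZeroAtTwo ∧ WallSupersingularRankZeroAtTwo ∧
      WallAdditiveRankZeroAtTwo)
    (hGZK : rank_eq_analyticRank_of_analyticRank_le_one) (hmod : hasEntireLFunction_rat)
    (hnf : exists_isNewformOf) (hMilneC : Milne1972.bsdQuotient_baseChange_quadratic_anyModel)
    (hWald : waldspurger_exists_heegnerField_twist_ne_zero)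
    (hLaw : GrossIndexLawAtTwo) : CyclicTwoTorsionRankOneAtTwo := by
  intro W _ _ hcm hr hT hcyc
  obtain ⟨hOrd, hMult, hSS, hAdd⟩ := hW
  haveI : NeZero (W.conductorNorm ℤ) := ⟨(W.conductorNorm_pos_holds).ne'⟩
  have hroot : W.rootNumber = -1 := rootNumber_eq_neg_one_of_analyticRank_eq_one hnf W hr
  obtain ⟨K, _, _, hK, -, hHH, hL⟩ := hWald W hroot 0
  obtain ⟨h2, -⟩ := id hK
  have hrd0 : (W.quadraticTwist (NumberField.discr K : ℚ)).analyticRank = 0 :=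
    Literature.NumberTheory.EllipticCurves.analyticRank_eq_zero_of_entireLFunction_one_ne_zero _ hL
  obtain ⟨Wd, _, _, hWd, hrd, hBd⟩ := exists_minimalTwin_bsdp_of_wall hOrd hMult hSS hAdd W hcm K hrd0
  have hKin : MissingPPartOverCAt (W.baseChange K) 2 := hLaw W hcm hr hT hcyc K hK hHH hrd0
  exact bsdp_of_pPartOverC_baseChange W 2 K Wd hGZK hmod hMilneC hr.le h2 hWd (hrd.trans_le zero_le_one) hKin hBd

/-- **GROSS INDEX LAW ⟸ WALL + PRINT + CYC** (the frame, backward: the change of language is LOSSLESS). -/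
theorem grossIndexLaw_of_cyc
    (hW : WallGoodOrdinaryRankZeroAtTwo ∧ WallMultiplicativeRankZeroAtTwo ∧ WallSupersingularRankZeroAtTwo ∧
      WallAdditiveRankZeroAtTwo)
    (hGZK : rank_eq_analyticRank_of_analyticRank_le_one) (hmod : hasEntireLFunction_rat)
    (hMilneC : Milne1972.bsdQuotient_baseChange_quadratic_anyModel)
    (hcyc : CyclicTwoTorsionRankOneAtTwo) : GrossIndexLawAtTwo := by
  intro W _ _ hcm hr hT hc K _ _ hK hHH hrd0
  obtain ⟨hOrd, hMult, hSS, hAdd⟩ := hW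
  obtain ⟨h2, -⟩ := id hK
  obtain ⟨Wd, _, _, hWd, hrd, hBd⟩ := exists_minimalTwin_bsdp_of_wall hOrd hMult hSS hAdd W hcm K hrd0
  exact (missingPPartOverCAt_baseChange_iff_bsdp W 2 K Wd hGZK hmod hMilneC hr.le h2 hWd (hrd.trans_le zero_le_one) hBd).mpr
    (hcyc W hcm hr hT hc)

/-- The frame as an `iff` (modulo WALL + PRINT). -/
theorem cyc_iff_grossIndexLaw
    (hW : WallGoodOrdinaryRankZeroAtTwo ∧ WallMultiplicativeRankZeroAtTwo ∧ WallSupersingularRankZeroAtTwo ∧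
      WallAdditiveRankZeroAtTwo)
    (hGZK : rank_eq_analyticRank_of_analyticRank_le_one) (hmod : hasEntireLFunction_rat)
    (hnf : exists_isNewformOf) (hMilneC : Milne1972.bsdQuotient_baseChange_quadratic_anyModel)
    (hWald : waldspurger_exists_heegnerField_twist_ne_zero) :
    CyclicTwoTorsionRankOneAtTwo ↔ GrossIndexLawAtTwo :=
  ⟨grossIndexLaw_of_cyc hW hGZK hmod hMilneC, cyc_of_grossIndexLaw hW hGZK hmod hnf hMilneC hWald⟩

/-- **Halves make the law** (kernel: the rational `q` with `#Ш_an(W ⊗ K) = q` is unique, then antisymmetry;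
`AdditivePotMult.missingPPartOverCAt_of_lower_of_upper`). -/
theorem grossIndexLaw_of_halves (hU : GrossIndexUpperHalfAtTwo) (hL : GrossIndexLowerHalfAtTwo) :
    GrossIndexLawAtTwo := by
  intro W _ _ hcm hr hT hc K _ _ hK hHH hrd0
  exact missingPPartOverCAt_of_lower_of_upper _ 2 (hL W hcm hr hT hc K hK hHH hrd0) (hU W hcm hr hT hc K hK hHH hrd0)

/-- **The law gives both halves** (kernel). -/
theorem halves_of_grossIndexLaw (hLaw : GrossIndexLawAtTwo) :
    GrossIndexUpperHalfAtTwo ∧ GrossIndexLowerHalfAtTwo := by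
  refine ⟨fun W _ _ hcm hr hT hc K _ _ hK hHH hrd0 ↦ ?_, fun W _ _ hcm hr hT hc K _ _ hK hHH hrd0 ↦ ?_⟩
  · exact (lower_and_upper_of_missingPPartOverCAt _ 2 (hLaw W hcm hr hT hc K hK hHH hrd0)).2
  · exact (lower_and_upper_of_missingPPartOverCAt _ 2 (hLaw W hcm hr hT hc K hK hHH hrd0)).1

/-- So, modulo WALL + PRINT, **CYC ⟺ UPPER ∧ LOWER** (kernel). -/
theorem cyc_iff_halves
    (hW : WallGoodOrdinaryRankZeroAtTwo ∧ WallMultiplicativeRankZeroAtTwo ∧ WallSupersingularRankZeroAtTwo ∧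
      WallAdditiveRankZeroAtTwo)
    (hGZK : rank_eq_analyticRank_of_analyticRank_le_one) (hmod : hasEntireLFunction_rat)
    (hnf : exists_isNewformOf) (hMilneC : Milne1972.bsdQuotient_baseChange_quadratic_anyModel)
    (hWald : waldspurger_exists_heegnerField_twist_ne_zero) :
    CyclicTwoTorsionRankOneAtTwo ↔ GrossIndexUpperHalfAtTwo ∧ GrossIndexLowerHalfAtTwo := by
  rw [cyc_iff_grossIndexLaw hW hGZK hmod hnf hMilneC hWald]
  exact ⟨halves_of_grossIndexLaw, fun h ↦ grossIndexLaw_of_halves h.1 h.2⟩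

/-- **CYC ⟸ WALL + PRINT + LAW∃** (kernel; the prover-facing composition — Waldspurger is no longer needed, the
research stub supplies its own field). -/
theorem cyc_of_grossIndexLawExists
    (hW : WallGoodOrdinaryRankZeroAtTwo ∧ WallMultiplicativeRankZeroAtTwo ∧ WallSupersingularRankZeroAtTwo ∧
      WallAdditiveRankZeroAtTwo)
    (hGZK : rank_eq_analyticRank_of_analyticRank_le_one) (hmod : hasEntireLFunction_rat)
    (hMilneC : Milne1972.bsdQuotient_baseChange_quadratic_anyModel)
    (hLaw : GrossIndexLawExistsAtTwo) : CyclicTwoTorsionRankOneAtTwo := by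
  intro W _ _ hcm hr hT hcyc
  obtain ⟨hOrd, hMult, hSS, hAdd⟩ := hW
  obtain ⟨K, _, _, hK, -, hrd0, hKin⟩ := hLaw W hcm hr hT hcyc
  obtain ⟨h2, -⟩ := id hK
  obtain ⟨Wd, _, _, hWd, hrd, hBd⟩ := exists_minimalTwin_bsdp_of_wall hOrd hMult hSS hAdd W hcm K hrd0
  exact bsdp_of_pPartOverC_baseChange W 2 K Wd hGZK hmod hMilneC hr.le h2 hWd (hrd.trans_le zero_le_one) hKin hBd

/-- **LAW∃ ⟸ LAW** given Waldspurger's frame and the newform (kernel): the `∀K` law specialised at a Waldspurger field. -/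
theorem grossIndexLawExists_of_grossIndexLaw (hnf : exists_isNewformOf)
    (hWald : waldspurger_exists_heegnerField_twist_ne_zero) (hLaw : GrossIndexLawAtTwo) :
    GrossIndexLawExistsAtTwo := by
  intro W _ _ hcm hr hT hcyc
  haveI : NeZero (W.conductorNorm ℤ) := ⟨(W.conductorNorm_pos_holds).ne'⟩
  have hroot : W.rootNumber = -1 := rootNumber_eq_neg_one_of_analyticRank_eq_one hnf W hr
  obtain ⟨K, iF, iN, hK, -, hHH, hL⟩ := hWald W hroot 0
  have hrd0 : (W.quadraticTwist (NumberField.discr K : ℚ)).analyticRank = 0 :=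
    Literature.NumberTheory.EllipticCurves.analyticRank_eq_zero_of_entireLFunction_one_ne_zero _ hL
  exact ⟨K, iF, iN, hK, hHH, hrd0, hLaw W hcm hr hT hcyc K hK hHH hrd0⟩

/-- **LAW∃ ⟸ WALL + PRINT + CYC** (kernel): so LAW∃, too, is a lossless currency for CYC modulo WALL + PRINT. -/
theorem grossIndexLawExists_of_cyc
    (hW : WallGoodOrdinaryRankZeroAtTwo ∧ WallMultiplicativeRankZeroAtTwo ∧ WallSupersingularRankZeroAtTwo ∧
      WallAdditiveRankZeroAtTwo)
    (hGZK : rank_eq_analyticRank_of_analyticRank_le_one) (hmod : hasEntireLFunction_rat)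
    (hnf : exists_isNewformOf) (hMilneC : Milne1972.bsdQuotient_baseChange_quadratic_anyModel)
    (hWald : waldspurger_exists_heegnerField_twist_ne_zero)
    (hcyc : CyclicTwoTorsionRankOneAtTwo) : GrossIndexLawExistsAtTwo :=
  grossIndexLawExists_of_grossIndexLaw hnf hWald (grossIndexLaw_of_cyc hW hGZK hmod hMilneC hcyc)

/-- **LAW∃ ⟸ UPPER ∧ LOWER** (kernel, via the law). -/
theorem grossIndexLawExists_of_halves (hnf : exists_isNewformOf)
    (hWald : waldspurger_exists_heegnerField_twist_ne_zero)
    (hU : GrossIndexUpperHalfAtTwo) (hL : GrossIndexLowerHalfAtTwo) : GrossIndexLawExistsAtTwo :=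
  grossIndexLawExists_of_grossIndexLaw hnf hWald (grossIndexLaw_of_halves hU hL)

/-! ## §6 Kernel-checked: the law UNFOLDED under a Heegner point, and the torsion inside the index -/

/-- **The law in index form.**  Under a Heegner point `P ∈ E(K)` over the datum `(Dt, H)` and `ord_{s=1} L(E_K,s) = 1`,
the exact Gross–Zagier identity (`shaAnOverC_baseChange_eq_of_heegner`) turns `MissingPPartOverCAt (W ⊗ K) 2` into
«`ord₂ (4·[E(K):ℤP]² / (c²·w_K²·(∏c_ℓ)²)) = ord₂ #Ш(W ⊗ K)`». -/
theorem missingPPartOverCAt_two_iff_indexQuotient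
    (W : WeierstrassCurve ℚ) [W.IsElliptic] [W.IsGloballyMinimal] [NeZero (W.conductorNorm ℤ)]
    (K : Type) [Field K] [NumberField K]
    (Dt : ModularParametrizationData W (W.conductorNorm ℤ))
    (H : HeegnerDatum (W.conductorNorm ℤ) (NumberField.discr K)) (ι : K →+* ℂ)
    (P : (W.baseChange K).toAffine.Point)
    (hGZ : gross_zagier (W.conductorNorm ℤ) W K)
    (hGZK : rank_eq_analyticRank_of_analyticRank_le_one) (hmod : hasEntireLFunction_rat)
    (hK : IsImaginaryQuadratic K) (hH : SatisfiesHeegnerHypothesis (W.conductorNorm ℤ) K)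
    (hP : WeierstrassCurve.Affine.Point.map ι.toRatAlgHom P = heegnerPointComplex Dt H)
    (hc0 : Dt.c ≠ 0) (hr : (W.baseChange K).analyticRank = 1) :
    MissingPPartOverCAt (W.baseChange K) 2 ↔
      padicValRat 2 (4 * ((AddSubgroup.zmultiples P).index : ℚ) ^ 2 /
          ((Dt.c : ℚ) ^ 2 * (Units.torsionOrder K : ℚ) ^ 2 * ((W.tamagawaProduct : ℚ) ^ 2))) =
        padicValNat 2 (W.baseChange K).shaOrder := by
  obtain ⟨-, -, -, hsha⟩ :=
    shaAnOverC_baseChange_eq_of_heegner W K Dt H ι P hGZ hGZK hmod hK hH hP hc0 hr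
  constructor
  · rintro ⟨q, hq, hv⟩
    have hqq : (q : ℂ) = ((4 * ((AddSubgroup.zmultiples P).index : ℚ) ^ 2 /
        ((Dt.c : ℚ) ^ 2 * (Units.torsionOrder K : ℚ) ^ 2 * ((W.tamagawaProduct : ℚ) ^ 2)) : ℚ) : ℂ) :=
      hq.symm.trans hsha
    rw [← Rat.cast_injective hqq]
    exact hv
  · intro hv
    exact ⟨_, hsha, hv⟩

/-- **The valuation of the Gross index quotient** (pure arithmetic):
`ord₂ (4·I²/(c²·w²·T²)) = 2 + 2·ord₂ I − 2·ord₂ c − 2·ord₂ w − 2·ord₂ T` (`c : ℤ`, the Manin constant of the datum). -/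
theorem padicValRat_grossIndexQuotient {I w T : ℕ} {c : ℤ} (hI : I ≠ 0) (hc : c ≠ 0) (hw : w ≠ 0)
    (hT : T ≠ 0) :
    padicValRat 2 (4 * (I : ℚ) ^ 2 / ((c : ℚ) ^ 2 * (w : ℚ) ^ 2 * ((T : ℚ) ^ 2))) =
      2 + 2 * (padicValNat 2 I : ℤ) - 2 * (padicValInt 2 c : ℤ) - 2 * (padicValNat 2 w : ℤ)
        - 2 * (padicValNat 2 T : ℤ) := by
  have hI' : (I : ℚ) ≠ 0 := by exact_mod_cast hI
  have hc' : (c : ℚ) ≠ 0 := by exact_mod_cast hc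
  have hw' : (w : ℚ) ≠ 0 := by exact_mod_cast hw
  have hT' : (T : ℚ) ≠ 0 := by exact_mod_cast hT
  have h4 : (4 : ℚ) = ((2 : ℕ) : ℚ) ^ 2 := by norm_num
  rw [padicValRat.div (mul_ne_zero (by norm_num : (4:ℚ) ≠ 0) (pow_ne_zero 2 hI'))
      (mul_ne_zero (mul_ne_zero (pow_ne_zero 2 hc') (pow_ne_zero 2 hw')) (pow_ne_zero 2 hT')),
    padicValRat.mul (by norm_num : (4:ℚ) ≠ 0) (pow_ne_zero 2 hI'),
    padicValRat.mul (mul_ne_zero (pow_ne_zero 2 hc') (pow_ne_zero 2 hw')) (pow_ne_zero 2 hT'),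
    padicValRat.mul (pow_ne_zero 2 hc') (pow_ne_zero 2 hw'), h4,
    padicValRat.pow ((2 : ℕ) : ℚ), padicValRat.pow (I : ℚ), padicValRat.pow (c : ℚ), padicValRat.pow (w : ℚ),
    padicValRat.pow (T : ℚ), padicValRat.self one_lt_two, padicValRat.of_nat, padicValRat.of_nat,
    padicValRat.of_nat, padicValRat.of_int]
  push_cast
  ring

/-- **The law, fully explicit.**  Under the hypotheses of `missingPPartOverCAt_two_iff_indexQuotient` (so `P` has
infinite order and the index is finite and non-zero): `MissingPPartOverCAt (W ⊗ K) 2 ⟺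
ord₂ #Ш(W ⊗ K) = 2 + 2·ord₂[E(K):ℤP] − 2·ord₂ c − 2·ord₂ w_K − 2·ord₂ ∏c_ℓ`. -/
theorem missingPPartOverCAt_two_iff_valuation
    (W : WeierstrassCurve ℚ) [W.IsElliptic] [W.IsGloballyMinimal] [NeZero (W.conductorNorm ℤ)]
    (K : Type) [Field K] [NumberField K]
    (Dt : ModularParametrizationData W (W.conductorNorm ℤ))
    (H : HeegnerDatum (W.conductorNorm ℤ) (NumberField.discr K)) (ι : K →+* ℂ)
    (P : (W.baseChange K).toAffine.Point)
    (hGZ : gross_zagier (W.conductorNorm ℤ) W K)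
    (hGZK : rank_eq_analyticRank_of_analyticRank_le_one) (hmod : hasEntireLFunction_rat)
    (hK : IsImaginaryQuadratic K) (hH : SatisfiesHeegnerHypothesis (W.conductorNorm ℤ) K)
    (hP : WeierstrassCurve.Affine.Point.map ι.toRatAlgHom P = heegnerPointComplex Dt H)
    (hc0 : Dt.c ≠ 0) (hr : (W.baseChange K).analyticRank = 1)
    (hI0 : (AddSubgroup.zmultiples P).index ≠ 0) :
    MissingPPartOverCAt (W.baseChange K) 2 ↔
      (padicValNat 2 (W.baseChange K).shaOrder : ℤ) =
        2 + 2 * (padicValNat 2 (AddSubgroup.zmultiples P).index : ℤ) - 2 * (padicValInt 2 Dt.c : ℤ)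
          - 2 * (padicValNat 2 (Units.torsionOrder K) : ℤ) - 2 * (padicValNat 2 W.tamagawaProduct : ℤ) := by
  rw [missingPPartOverCAt_two_iff_indexQuotient W K Dt H ι P hGZ hGZK hmod hK hH hP hc0 hr,
    padicValRat_grossIndexQuotient hI0 hc0 (Units.torsionOrder_ne_zero K) W.tamagawaProduct_pos_holds.ne']
  constructor <;> intro h <;> linarith

/-- **UPPER half, fully explicit** under a Heegner point: `MissingUpperBoundOverCAt (W ⊗ K) 2 ⟺
ord₂ #Ш(W ⊗ K) ≤ 2 + 2·ord₂[E(K):ℤP] − 2·ord₂ c − 2·ord₂ w_K − 2·ord₂ ∏c_ℓ`. -/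
theorem missingUpperBoundOverCAt_two_iff_valuation
    (W : WeierstrassCurve ℚ) [W.IsElliptic] [W.IsGloballyMinimal] [NeZero (W.conductorNorm ℤ)]
    (K : Type) [Field K] [NumberField K]
    (Dt : ModularParametrizationData W (W.conductorNorm ℤ))
    (H : HeegnerDatum (W.conductorNorm ℤ) (NumberField.discr K)) (ι : K →+* ℂ)
    (P : (W.baseChange K).toAffine.Point)
    (hGZ : gross_zagier (W.conductorNorm ℤ) W K)
    (hGZK : rank_eq_analyticRank_of_analyticRank_le_one) (hmod : hasEntireLFunction_rat)
    (hK : IsImaginaryQuadratic K) (hH : SatisfiesHeegnerHypothesis (W.conductorNorm ℤ) K)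
    (hP : WeierstrassCurve.Affine.Point.map ι.toRatAlgHom P = heegnerPointComplex Dt H)
    (hc0 : Dt.c ≠ 0) (hr : (W.baseChange K).analyticRank = 1)
    (hI0 : (AddSubgroup.zmultiples P).index ≠ 0) :
    MissingUpperBoundOverCAt (W.baseChange K) 2 ↔
      (padicValNat 2 (W.baseChange K).shaOrder : ℤ) ≤
        2 + 2 * (padicValNat 2 (AddSubgroup.zmultiples P).index : ℤ) - 2 * (padicValInt 2 Dt.c : ℤ)
          - 2 * (padicValNat 2 (Units.torsionOrder K) : ℤ) - 2 * (padicValNat 2 W.tamagawaProduct : ℤ) := by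
  obtain ⟨-, -, -, hsha⟩ :=
    shaAnOverC_baseChange_eq_of_heegner W K Dt H ι P hGZ hGZK hmod hK hH hP hc0 hr
  rw [← padicValRat_grossIndexQuotient hI0 hc0 (Units.torsionOrder_ne_zero K) W.tamagawaProduct_pos_holds.ne']
  constructor
  · rintro ⟨q, hq, hv⟩
    have hqq : (q : ℂ) = ((4 * ((AddSubgroup.zmultiples P).index : ℚ) ^ 2 /
        ((Dt.c : ℚ) ^ 2 * (Units.torsionOrder K : ℚ) ^ 2 * ((W.tamagawaProduct : ℚ) ^ 2)) : ℚ) : ℂ) :=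
      hq.symm.trans hsha
    rw [← Rat.cast_injective hqq]
    exact hv
  · intro hv
    exact ⟨_, hsha, hv⟩

/-- **LOWER half, fully explicit** under a Heegner point: `MissingLowerBoundOverCAt (W ⊗ K) 2 ⟺
2 + 2·ord₂[E(K):ℤP] − 2·ord₂ c − 2·ord₂ w_K − 2·ord₂ ∏c_ℓ ≤ ord₂ #Ш(W ⊗ K)`. -/
theorem missingLowerBoundOverCAt_two_iff_valuation
    (W : WeierstrassCurve ℚ) [W.IsElliptic] [W.IsGloballyMinimal] [NeZero (W.conductorNorm ℤ)]
    (K : Type) [Field K] [NumberField K]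
    (Dt : ModularParametrizationData W (W.conductorNorm ℤ))
    (H : HeegnerDatum (W.conductorNorm ℤ) (NumberField.discr K)) (ι : K →+* ℂ)
    (P : (W.baseChange K).toAffine.Point)
    (hGZ : gross_zagier (W.conductorNorm ℤ) W K)
    (hGZK : rank_eq_analyticRank_of_analyticRank_le_one) (hmod : hasEntireLFunction_rat)
    (hK : IsImaginaryQuadratic K) (hH : SatisfiesHeegnerHypothesis (W.conductorNorm ℤ) K)
    (hP : WeierstrassCurve.Affine.Point.map ι.toRatAlgHom P = heegnerPointComplex Dt H)
    (hc0 : Dt.c ≠ 0) (hr : (W.baseChange K).analyticRank = 1)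
    (hI0 : (AddSubgroup.zmultiples P).index ≠ 0) :
    MissingLowerBoundOverCAt (W.baseChange K) 2 ↔
      2 + 2 * (padicValNat 2 (AddSubgroup.zmultiples P).index : ℤ) - 2 * (padicValInt 2 Dt.c : ℤ)
          - 2 * (padicValNat 2 (Units.torsionOrder K) : ℤ) - 2 * (padicValNat 2 W.tamagawaProduct : ℤ) ≤
        (padicValNat 2 (W.baseChange K).shaOrder : ℤ) := by
  obtain ⟨-, -, -, hsha⟩ :=
    shaAnOverC_baseChange_eq_of_heegner W K Dt H ι P hGZ hGZK hmod hK hH hP hc0 hr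
  rw [← padicValRat_grossIndexQuotient hI0 hc0 (Units.torsionOrder_ne_zero K) W.tamagawaProduct_pos_holds.ne']
  constructor
  · rintro ⟨q, hq, hv⟩
    have hqq : (q : ℂ) = ((4 * ((AddSubgroup.zmultiples P).index : ℚ) ^ 2 /
        ((Dt.c : ℚ) ^ 2 * (Units.torsionOrder K : ℚ) ^ 2 * ((W.tamagawaProduct : ℚ) ^ 2)) : ℚ) : ℂ) :=
      hq.symm.trans hsha
    rw [← Rat.cast_injective hqq]
    exact hv
  · intro hv
    exact ⟨_, hsha, hv⟩

/-- **GROSS–ZAGIER 2-INTEGRALITY from the UPPER half** (the cheapest consequence; Jetchev's Conjecture 1.3 /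
Theorem 1.4 shape at `p = 2`): under a Heegner point, `ord₂ c + ord₂ w_K + ord₂ ∏c_ℓ ≤ 1 + ord₂ [E(K):ℤP]`
(because `ord₂ #Ш ≥ 0`).  INSTRUMENT kit:j343520: with `c = 1`, `w_K = 2` this reads `ord₂ ∏c_ℓ ≤ ord₂ [E(K):ℤP]`,
observed in 279/279 pairs `(E, K)` below conductor 700. -/
theorem two_integrality_of_upperHalf
    (W : WeierstrassCurve ℚ) [W.IsElliptic] [W.IsGloballyMinimal] [NeZero (W.conductorNorm ℤ)]
    (K : Type) [Field K] [NumberField K]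
    (Dt : ModularParametrizationData W (W.conductorNorm ℤ))
    (H : HeegnerDatum (W.conductorNorm ℤ) (NumberField.discr K)) (ι : K →+* ℂ)
    (P : (W.baseChange K).toAffine.Point)
    (hGZ : gross_zagier (W.conductorNorm ℤ) W K)
    (hGZK : rank_eq_analyticRank_of_analyticRank_le_one) (hmod : hasEntireLFunction_rat)
    (hK : IsImaginaryQuadratic K) (hH : SatisfiesHeegnerHypothesis (W.conductorNorm ℤ) K)
    (hP : WeierstrassCurve.Affine.Point.map ι.toRatAlgHom P = heegnerPointComplex Dt H)
    (hc0 : Dt.c ≠ 0) (hr : (W.baseChange K).analyticRank = 1)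
    (hI0 : (AddSubgroup.zmultiples P).index ≠ 0)
    (hU : MissingUpperBoundOverCAt (W.baseChange K) 2) :
    (padicValInt 2 Dt.c : ℤ) + (padicValNat 2 (Units.torsionOrder K) : ℤ) + (padicValNat 2 W.tamagawaProduct : ℤ) ≤
      1 + (padicValNat 2 (AddSubgroup.zmultiples P).index : ℤ) := by
  have h := (missingUpperBoundOverCAt_two_iff_valuation W K Dt H ι P hGZ hGZK hmod hK hH hP hc0 hr hI0).mp hU
  have h0 : (0 : ℤ) ≤ (padicValNat 2 (W.baseChange K).shaOrder : ℤ) := by positivity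
  linarith

/-- In an additive commutative group the torsion subgroup meets the multiples of a point of infinite order
trivially, so it embeds in `A ⧸ ℤP` and its cardinality divides the index `[A : ℤP]`. -/
theorem natCard_torsion_dvd_index_zmultiples {A : Type*} [AddCommGroup A] (P : A)
    (hP : ¬ IsOfFinAddOrder P) :
    Nat.card (AddCommGroup.torsion A) ∣ (AddSubgroup.zmultiples P).index := by
  let f : AddCommGroup.torsion A →+ A ⧸ AddSubgroup.zmultiples P :=
    (QuotientAddGroup.mk' (AddSubgroup.zmultiples P)).comp (AddCommGroup.torsion A).subtype
  have hf : Function.Injective f := by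
    intro x y hxy
    apply Subtype.ext
    have h : ((x : A) - y) ∈ AddSubgroup.zmultiples P := by
      rw [← QuotientAddGroup.eq_iff_sub_mem]
      exact hxy
    obtain ⟨k, hk⟩ := AddSubgroup.mem_zmultiples_iff.mp h
    have htor : IsOfFinAddOrder ((x : A) - y) :=
      (AddCommGroup.mem_torsion _).mp (sub_mem x.2 y.2)
    rw [← hk] at htor
    by_cases hk0 : k = 0
    · have : (x : A) - y = 0 := by rw [← hk, hk0, zero_zsmul]
      exact sub_eq_zero.mp this
    · exfalso
      obtain ⟨n, hn, hnk⟩ := (isOfFinAddOrder_iff_nsmul_eq_zero).mp htor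
      apply hP
      rw [isOfFinAddOrder_iff_zsmul_eq_zero]
      refine ⟨(n : ℤ) * k, mul_ne_zero (by exact_mod_cast hn.ne') hk0, ?_⟩
      rw [mul_zsmul, natCast_zsmul]
      exact hnk
  rw [AddSubgroup.index]
  exact AddSubgroup.card_dvd_of_injective f hf

/-- **The torsion is inside the index.**  On the torsion cell (`W(ℚ)` has a non-zero point killed by `2`), for every
number field `K` and every `P ∈ E(K)` of infinite order, `2 ∣ #E(K)_tors ∣ [E(K) : ℤP]`; in particular the Gross index
`[E(K):ℤP_K]` of §6 is EVEN on all of R″'s population, and `ord₂` of it splits as `ord₂ #E(K)_tors + (free 2-depth of P_K)`. -/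
theorem two_dvd_index_zmultiples_of_rational_two_torsion (W : WeierstrassCurve ℚ) [W.IsElliptic]
    (hT : ¬ ∀ P : W.toAffine.Point, 2 • P = 0 → P = 0) (K : Type) [Field K] [NumberField K]
    (P : (W.baseChange K).toAffine.Point) (hP : ¬ IsOfFinAddOrder P) :
    2 ∣ (AddSubgroup.zmultiples P).index := by
  haveI : (W.baseChange K).IsElliptic := inferInstanceAs (W.map (algebraMap ℚ K)).IsElliptic
  push Not at hT
  obtain ⟨T, h2T, hT0⟩ := hT
  let ι : W.toAffine.Point →+ (W.baseChange K).toAffine.Point := Affine.Point.baseChange (W' := W) ℚ K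
  have hι : Function.Injective ι := Affine.Point.map_injective (W' := W) _
  have hιT0 : ι T ≠ 0 := fun h ↦ hT0 (hι (by rw [h, map_zero]))
  have h2ιT : 2 • ι T = 0 := by rw [← map_nsmul, h2T, map_zero]
  have hord : addOrderOf (ι T) = 2 := by
    rcases (Nat.dvd_prime Nat.prime_two).mp (addOrderOf_dvd_of_nsmul_eq_zero h2ιT) with h1 | h2
    · exact absurd (AddMonoid.addOrderOf_eq_one_iff.mp h1) hιT0
    · exact h2
  have hmem : ι T ∈ AddCommGroup.torsion (W.baseChange K).toAffine.Point :=
    (AddCommGroup.mem_torsion _).mpr (addOrderOf_pos_iff.mp (by rw [hord]; norm_num))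
  have h2tors : 2 ∣ Nat.card (AddCommGroup.torsion (W.baseChange K).toAffine.Point) := by
    have h := addOrderOf_dvd_natCard
      (⟨ι T, hmem⟩ : AddCommGroup.torsion (W.baseChange K).toAffine.Point)
    rwa [AddSubgroup.addOrderOf_mk, hord] at h
  exact h2tors.trans (natCard_torsion_dvd_index_zmultiples P hP)

/-! ## §7 Kernel-checked: the carve and the crux BY NAME -/

/-- **R″ ⟸ WALL + PRINT + GROSS INDEX LAW**: §5 gives CYC, LINE 45's leaf (§4) gives RES-A from CYC, split on
cyclic vs full rational `2`-torsion. -/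
theorem residual_of_inputs
    (hW : WallGoodOrdinaryRankZeroAtTwo ∧ WallMultiplicativeRankZeroAtTwo ∧ WallSupersingularRankZeroAtTwo ∧
      WallAdditiveRankZeroAtTwo)
    (hP : rank_eq_analyticRank_of_analyticRank_le_one ∧ bsdRHS_eq_of_isIsogenous ∧ hasEntireLFunction_rat ∧
      exists_isNewformOf ∧ Milne1972.bsdQuotient_baseChange_quadratic_anyModel ∧
        waldspurger_exists_heegnerField_twist_ne_zero)
    (hLaw : GrossIndexLawAtTwo) : RankOneTwoTorsionResidualAtTwo := by
  obtain ⟨hGZK, hCassels, hmod, hnf, hMilneC, hWald⟩ := hP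
  have hcyc : CyclicTwoTorsionRankOneAtTwo := cyc_of_grossIndexLaw hW hGZK hmod hnf hMilneC hWald hLaw
  intro W _ _ hcm hr hT
  by_cases h : HasCyclicRationalTwoTorsion W
  · exact hcyc W hcm hr hT h
  · exact fullTwoTorsionResidual_of_cyclic hGZK hCassels hmod hcyc W hcm hr hT h

/-- **The crux BY NAME** (proof-of-item shape): `GenusKolyvaginAtTwo.RankOneTwoTorsionResidualAtTwo` from the three
registered stubs.  OPEN mathematics lives in the two HALVES `stub_grossIndexUpperHalfAtTwo` (Euler-system direction) /
`stub_grossIndexLowerHalfAtTwo` (construction direction) and in `stub_wallByName` (route binders) only; `stub_print`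
is literature as printed. -/
theorem RankOneTwoTorsionResidualAtTwo_of : RankOneTwoTorsionResidualAtTwo :=
  residual_of_inputs stub_wallByName stub_print
    (grossIndexLaw_of_halves stub_grossIndexUpperHalfAtTwo stub_grossIndexLowerHalfAtTwo)


/-! ## §8 ℚ-currency (v1.2): the halves are INTRINSIC to `W` — the Heegner field is pure currency

`MissingUpperBoundAt W 2` / `MissingLowerBoundAt W 2` (`Rank1Residual.Typed`: `#Ш_an(W)` is a rational `q` with
`ord₂ #Ш(W) ≤ ord₂ q`, resp. `ord₂ q ≤ ord₂ #Ш(W)`) are the two inequalities of `BSD₂(W)` itself.  On CYC they are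
EQUIVALENT to the `K`-halves of §0 modulo WALL + PRINT (the `2`-adic BSD defect is invariant under the quadratic descent,
`AdditivePotMult.missingUpperBoundAt_iff_overC`, Milne any-model), and CYC ⟺ UPPER_ℚ ∧ LOWER_ℚ modulo GZK alone.  So the
`∀K`/`∃K` distinction (critic #675 P1) is immaterial modulo WALL + PRINT, and what the frame ADDS is exactly the conversion of the
transcendental `#Ш_an(W)` into the integer index expression of §6. -/

/-- UPPER over `ℚ` on the cyclic-torsion cell: `ord₂ #Ш(W) ≤ ord₂ #Ш_an(W)`. -/
def CyclicUpperHalfOverQAtTwo : Prop :=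
  ∀ (W : WeierstrassCurve ℚ) [W.IsElliptic] [W.IsGloballyMinimal],
    ¬ W.HasCM → W.analyticRank = 1 → (¬ ∀ P : W.toAffine.Point, 2 • P = 0 → P = 0) →
    HasCyclicRationalTwoTorsion W → MissingUpperBoundAt W 2

/-- LOWER over `ℚ` on the cyclic-torsion cell: `ord₂ #Ш_an(W) ≤ ord₂ #Ш(W)`. -/
def CyclicLowerHalfOverQAtTwo : Prop :=
  ∀ (W : WeierstrassCurve ℚ) [W.IsElliptic] [W.IsGloballyMinimal],
    ¬ W.HasCM → W.analyticRank = 1 → (¬ ∀ P : W.toAffine.Point, 2 • P = 0 → P = 0) →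
    HasCyclicRationalTwoTorsion W → MissingLowerBoundAt W 2

/-- **CYC ⟺ UPPER_ℚ ∧ LOWER_ℚ** modulo GZK only (kernel): `BSD₂(W)` is the conjunction of its two inequalities. -/
theorem cyc_iff_halvesOverQ (hGZK : rank_eq_analyticRank_of_analyticRank_le_one) :
    CyclicTwoTorsionRankOneAtTwo ↔ CyclicUpperHalfOverQAtTwo ∧ CyclicLowerHalfOverQAtTwo := by
  constructor
  · intro hcyc
    refine ⟨fun W _ _ hcm hr hT hc ↦ ?_, fun W _ _ hcm hr hT hc ↦ ?_⟩
    · obtain ⟨-, hfin⟩ := hGZK W hr.le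
      haveI : Finite W.sha := hfin
      exact (lower_and_upper_of_missingPPartAt W 2 (missingPPartAt_of_bsdp W 2 (hcyc W hcm hr hT hc))).2
    · obtain ⟨-, hfin⟩ := hGZK W hr.le
      haveI : Finite W.sha := hfin
      exact (lower_and_upper_of_missingPPartAt W 2 (missingPPartAt_of_bsdp W 2 (hcyc W hcm hr hT hc))).1
  · rintro ⟨hU, hL⟩ W _ _ hcm hr hT hc
    exact bsdp_of_missingPPartAt W 2 hGZK hr.le
      (missingPPartAt_of_lower_of_upper W 2 (hL W hcm hr hT hc) (hU W hcm hr hT hc))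

/-- The one-sided descent iffs on the canonical model with Milne discharged and the twin taken from WALL (any Heegner-or-not
imaginary quadratic `K` with rank-zero twin): `MissingUpperBoundAt W 2 ↔ MissingUpperBoundOverCAt (W.baseChange K) 2`, dually. -/
theorem halves_iff_overC_of_wall
    (hW : WallGoodOrdinaryRankZeroAtTwo ∧ WallMultiplicativeRankZeroAtTwo ∧ WallSupersingularRankZeroAtTwo ∧
      WallAdditiveRankZeroAtTwo)
    (hGZK : rank_eq_analyticRank_of_analyticRank_le_one) (hmod : hasEntireLFunction_rat)
    (hMilneC : Milne1972.bsdQuotient_baseChange_quadratic_anyModel)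
    (W : WeierstrassCurve ℚ) [W.IsElliptic] [W.IsGloballyMinimal] (hcm : ¬ W.HasCM) (hr : W.analyticRank = 1)
    (K : Type) [Field K] [NumberField K] (hK : IsImaginaryQuadratic K)
    (hrd0 : (W.quadraticTwist (NumberField.discr K : ℚ)).analyticRank = 0) :
    (MissingUpperBoundAt W 2 ↔ MissingUpperBoundOverCAt (W.baseChange K) 2) ∧
      (MissingLowerBoundAt W 2 ↔ MissingLowerBoundOverCAt (W.baseChange K) 2) := by
  obtain ⟨hOrd, hMult, hSS, hAdd⟩ := hW
  obtain ⟨h2, -⟩ := id hK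
  obtain ⟨Wd, _, _, hWd, hrd, hBd⟩ := exists_minimalTwin_bsdp_of_wall hOrd hMult hSS hAdd W hcm K hrd0
  haveI : (W.baseChange K).IsElliptic := by rw [baseChange]; infer_instance
  have hV : ∃ C : VariableChange K, C • W.baseChange K = W.baseChange K := ⟨1, one_smul _ _⟩
  obtain ⟨-, hfinW⟩ := hGZK W hr.le
  obtain ⟨-, hfinD⟩ := hGZK Wd (hrd.trans_le zero_le_one)
  obtain ⟨hshaK, hWR⟩ := hMilneC W K h2 Wd hWd (W.baseChange K) hV hfinW hfinD
  exact ⟨missingUpperBoundAt_iff_overC W 2 K Wd (W.baseChange K) hmod h2 hWd hV hfinW hfinD hshaK hWR hBd,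
    missingLowerBoundAt_iff_overC W 2 K Wd (W.baseChange K) hmod h2 hWd hV hfinW hfinD hshaK hWR hBd⟩

/-- **UPPER_K ⟺ UPPER_ℚ modulo WALL + PRINT** (kernel). `→` specialises at a Waldspurger field; `←` works at every Heegner `K`. -/
theorem grossIndexUpperHalf_iff_upperOverQ
    (hW : WallGoodOrdinaryRankZeroAtTwo ∧ WallMultiplicativeRankZeroAtTwo ∧ WallSupersingularRankZeroAtTwo ∧
      WallAdditiveRankZeroAtTwo)
    (hGZK : rank_eq_analyticRank_of_analyticRank_le_one) (hmod : hasEntireLFunction_rat) (hnf : exists_isNewformOf)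
    (hMilneC : Milne1972.bsdQuotient_baseChange_quadratic_anyModel)
    (hWald : waldspurger_exists_heegnerField_twist_ne_zero) :
    GrossIndexUpperHalfAtTwo ↔ CyclicUpperHalfOverQAtTwo := by
  constructor
  · intro hU W _ _ hcm hr hT hc
    haveI : NeZero (W.conductorNorm ℤ) := ⟨(W.conductorNorm_pos_holds).ne'⟩
    have hroot : W.rootNumber = -1 := rootNumber_eq_neg_one_of_analyticRank_eq_one hnf W hr
    obtain ⟨K, _, _, hK, -, hHH, hL⟩ := hWald W hroot 0
    have hrd0 : (W.quadraticTwist (NumberField.discr K : ℚ)).analyticRank = 0 :=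
      Literature.NumberTheory.EllipticCurves.analyticRank_eq_zero_of_entireLFunction_one_ne_zero _ hL
    exact (halves_iff_overC_of_wall hW hGZK hmod hMilneC W hcm hr K hK hrd0).1.mpr (hU W hcm hr hT hc K hK hHH hrd0)
  · intro hUQ W _ _ hcm hr hT hc K _ _ hK hHH hrd0
    exact (halves_iff_overC_of_wall hW hGZK hmod hMilneC W hcm hr K hK hrd0).1.mp (hUQ W hcm hr hT hc)

/-- **LOWER_K ⟺ LOWER_ℚ modulo WALL + PRINT** (kernel). -/
theorem grossIndexLowerHalf_iff_lowerOverQ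
    (hW : WallGoodOrdinaryRankZeroAtTwo ∧ WallMultiplicativeRankZeroAtTwo ∧ WallSupersingularRankZeroAtTwo ∧
      WallAdditiveRankZeroAtTwo)
    (hGZK : rank_eq_analyticRank_of_analyticRank_le_one) (hmod : hasEntireLFunction_rat) (hnf : exists_isNewformOf)
    (hMilneC : Milne1972.bsdQuotient_baseChange_quadratic_anyModel)
    (hWald : waldspurger_exists_heegnerField_twist_ne_zero) :
    GrossIndexLowerHalfAtTwo ↔ CyclicLowerHalfOverQAtTwo := by
  constructor
  · intro hLo W _ _ hcm hr hT hc
    haveI : NeZero (W.conductorNorm ℤ) := ⟨(W.conductorNorm_pos_holds).ne'⟩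
    have hroot : W.rootNumber = -1 := rootNumber_eq_neg_one_of_analyticRank_eq_one hnf W hr
    obtain ⟨K, _, _, hK, -, hHH, hL⟩ := hWald W hroot 0
    have hrd0 : (W.quadraticTwist (NumberField.discr K : ℚ)).analyticRank = 0 :=
      Literature.NumberTheory.EllipticCurves.analyticRank_eq_zero_of_entireLFunction_one_ne_zero _ hL
    exact (halves_iff_overC_of_wall hW hGZK hmod hMilneC W hcm hr K hK hrd0).2.mpr (hLo W hcm hr hT hc K hK hHH hrd0)
  · intro hLQ W _ _ hcm hr hT hc K _ _ hK hHH hrd0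
    exact (halves_iff_overC_of_wall hW hGZK hmod hMilneC W hcm hr K hK hrd0).2.mp (hLQ W hcm hr hT hc)

end Summit.BirchSwinnertonDyer.BirchSwinnertonDyer.Cruxes.RankOneTwoTorsionResidualAtTwo.TorsionFrame

end
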